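import Summits.Ventures.LatticeQCDFlow.Scaling.FiniteOddsDominationLaw
import Summits.Ventures.LatticeQCDFlow.Scaling.TaggedDomination

/-!
HONEST FRAMING: exact (Metropolis-corrected) sampling algorithms for lattice gauge theory; figures
of merit are autocorrelation/cost numbers at stated couplings and volumes; no continuum-physics
claim.

# FiniteOddsLaw — THE LAW OF ITEM 1 (i) AT EVERY SWAP RATE, UNCONDITIONAL: FOR THE LUMPED STAR IN COMPOSITION VARIABLES WITH THE RESOLVENT END-HUB LAWS AT SWAP ODDS `σ` AND THE
# OPTIMAL END-HUB COUPLINGS, `d(n) ≤ ((K+1)(c+2K+2) + 2(K+1)(c+2K+6))·(1−ρ)ⁿ` WHENEVER `ρ(c+2K+2) ≤ 2σ·pE_{μ_0}[Wθ]`, ANY `c ≥ 2K+2` — CONJECTURE W OF MEMO-gen36 IS A THEOREM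
# (lean-2 GEN-38, ours)

Venture-side (OURS).  Cell `lqcd-flow` (pub-lqcd), unit `pub-lqcd-lean-2-g38`, 2026-08-30.  Chapter W (item 1 (i) at finite swap odds), file 27 = file 23 (`finiteOdds_domination_worstTvDist_le`,
the law from DOMINATION on oriented adjacent pairs) with its two domination hypotheses DISCHARGED by file 26 (`tagged_hub_domination`, `tagged_star_domination` — Conjecture M of
MEMO-gen37, proved by the shallow-node elimination of files 24–25).  What remains as hypotheses is data: the composition state space, the star-hub kernels, the resolvent end-hub laws
and their tails, the optimal couplings, the potential, and for every adjacent equal-hub pair the tagged chains and tagged tail laws of ONE orientation (hypothesis-equations; every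
object is determined by its equation).  With `c = 2K+2` and `ρ = σ(1−θ̄)/(2K+2)` (`1−θ̄ = pE_{μ_0}[Wθ]`) this is the law conjectured in MEMO-gen36 §5: order `(K/(σp))·log(K/ε)` refresh
cycles at EVERY swap rate, one potential for all swap rates.  Hypothesis-equations, no definitions.

## What is proved

* **`finiteOdds_worstTvDist_le`**.

Reading (no numerics implied): the finite-odds composition-chain law of OPEN-MATH item 1 (i) for the lumped star; the step chain (cycle → step) and configuration-vs-lumped mixing
remain as worded in OPEN-MATH.  Literature grade (cell rule): OWN on the tree's LPW files; nothing cited as a fact; no new bib keys.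
-/

open Finset Matrix
open Literature.Probability.MarkovChains

namespace Summit.Ventures.LatticeQCDFlow.Scaling

section Law
variable {X : Type*} [Fintype X] [DecidableEq X] {S : Type*} [Fintype S] [DecidableEq S]
variable {hub : X → S} {comp : X → S → ℕ} {K : ℕ} {μ0 W θ : S → ℝ} {p σ ρ C c : ℝ} {acc : S → S → ℝ} {Kh : (S → ℕ) → S → S → ℝ}
variable {u ut : X → S → ℝ} {qt q : X → X → S → S → ℝ}
variable {P : X → X → ℝ} {Q : Matrix (X × X) (X × X) ℝ} {Δ : (S → ℕ) → (S → ℕ) → ℕ} {F Ψ : X × X → ℝ}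
variable {NCf : X → X → S → ℕ} {af bf : X → X → S} {PXf PYf : X → X → Option S → Option S → ℝ} {xtf ytf xsf ysf : X → X → Option S → ℝ}

/-- **THE LAW OF ITEM 1 (i) AT EVERY SWAP RATE (unconditional).**  Setting of file 23: the refresh-cycle chain of the lumped star in composition variables, end-hub laws = the
resolvents at swap odds `σ ∈ [0,1)`, tail laws coupled by the LPW-4.7 optimal coupling, potential constant `c ≥ 2K+2`, rate `0 ≤ ρ ≤ ½` with `ρ(c+2K+2) ≤ 2σpE_{μ_0}[Wθ]`; for every
adjacent equal-hub ordered pair one orientation (`W(b) ≤ W(a)`) of the tagged hub chains and their tail laws from the hub and from ★ is supplied as hypothesis-equations.  Then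
`d(n) ≤ ((K+1)(c+2K+2) + 2(K+1)(c+2K+6))·(1−ρ)ⁿ` — NO domination hypothesis (files 24–26 prove it). [ours] -/
theorem finiteOdds_worstTvDist_le [Nonempty X] (hinj : ∀ x x', hub x = hub x' → comp x = comp x' → x = x') (hsum : ∀ x, ∑ v, comp x v = K + 1)
    (hsurj : ∀ (z : S) (N : S → ℕ), ∑ v, N v = K + 1 → N z ≠ 0 → ∃ x, hub x = z ∧ comp x = N) (hhub : ∀ x, comp x (hub x) ≠ 0) (hK : 1 ≤ K)
    (hW : ∀ v, 0 < W v) (hp0 : 0 ≤ p) (hp : ∀ v, p * W v ≤ 1) (hθ : ∀ v, θ v = 1 / (1 + p * W v)) (hacc : ∀ h v, acc h v = min 1 (W h / W v))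
    (hμ0 : ∀ v, 0 ≤ μ0 v) (hμ1 : ∑ v, μ0 v = 1) (hc : 2 * (K : ℝ) + 2 ≤ c) (hσ0 : 0 ≤ σ) (hσ1 : σ < 1) (hρ0 : 0 ≤ ρ) (hρ : ρ ≤ 1 / 2)
    (hρc : ρ * (c + 2 * K + 2) ≤ 2 * σ * (p * ∑ v, μ0 v * (W v * θ v)))
    (hKoff : ∀ N h v, h ≠ v → Kh N h v = if N h = 0 then 0 else (N v : ℝ) / K * acc h v) (hKdiag : ∀ N h, Kh N h h = 1 - ∑ v ∈ univ.erase h, Kh N h v)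
    (hu : ∀ x v, u x v = (1 - σ) * (if v = hub x then (1 : ℝ) else 0) + σ * ∑ h, u x h * Kh (comp x) h v)
    (hut : ∀ x v, ut x v = ∑ h, u x h * Kh (comp x) h v)
    (hqt : ∀ x y a b, qt x y a b = optimalCoupling (ut x) (ut y) a b)
    (hq : ∀ x y a b, q x y a b = (1 - σ) * ((if a = hub x then (1 : ℝ) else 0) * (if b = hub y then (1 : ℝ) else 0)) + σ * qt x y a b)
    (hΔ : ∀ N N', Δ N N' = ∑ v, (N v - N' v))
    (hP : ∀ x x', P x x' = ∑ a, u x a * (μ0 (hub x') * (if comp x' + Pi.single a 1 = comp x + Pi.single (hub x') 1 then (1 : ℝ) else 0)))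
    (hQ : ∀ x y x' y', Q (x, y) (x', y') = ∑ a, ∑ b, q x y a b * (μ0 (hub x')
      * (if comp x' + Pi.single a 1 = comp x + Pi.single (hub x') 1 then (1 : ℝ) else 0))
      * ((if hub y' = hub x' then (1 : ℝ) else 0) * (if comp y' + Pi.single b 1 = comp y + Pi.single (hub y') 1 then (1 : ℝ) else 0)))
    (hF : ∀ x y, F (x, y) = c + (-(1 - σ) * θ (hub x)) + (-(1 - σ) * θ (hub y)) + ∑ v, θ v * ((comp x v : ℝ) + (comp y v : ℝ)))
    (hC : C = 2 * ((K + 1) * (c + 2 * K + 6)))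
    (hΨ : ∀ x y, Ψ (x, y) = (Δ (comp x) (comp y) : ℝ) * F (x, y) + C * (if hub x = hub y then (0 : ℝ) else 1))
    -- the tagged data of every ORIENTED adjacent pair
    (horient : ∀ x y, hub x = hub y → Δ (comp x) (comp y) = 1 → W (bf x y) ≤ W (af x y) ∨ W (bf y x) ≤ W (af y x))
    (hcx : ∀ x y, hub x = hub y → Δ (comp x) (comp y) = 1 → W (bf x y) ≤ W (af x y) → comp x = NCf x y + Pi.single (af x y) 1)
    (hcy : ∀ x y, hub x = hub y → Δ (comp x) (comp y) = 1 → W (bf x y) ≤ W (af x y) → comp y = NCf x y + Pi.single (bf x y) 1)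
    (hPXoff : ∀ x y, hub x = hub y → Δ (comp x) (comp y) = 1 → W (bf x y) ≤ W (af x y) →
      ∀ h v, h ≠ v → PXf x y (some h) (some v) = if NCf x y h = 0 then 0 else (NCf x y v : ℝ) / K * acc h v)
    (hPXin : ∀ x y, hub x = hub y → Δ (comp x) (comp y) = 1 → W (bf x y) ≤ W (af x y) →
      ∀ h, PXf x y (some h) none = if NCf x y h = 0 then 0 else acc h (af x y) / K)
    (hPXdiag : ∀ x y, hub x = hub y → Δ (comp x) (comp y) = 1 → W (bf x y) ≤ W (af x y) →
      ∀ h, PXf x y (some h) (some h) = 1 - (∑ v ∈ univ.erase h, PXf x y (some h) (some v) + PXf x y (some h) none))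
    (hPXout : ∀ x y, hub x = hub y → Δ (comp x) (comp y) = 1 → W (bf x y) ≤ W (af x y) → ∀ v, PXf x y none (some v) = (NCf x y v : ℝ) / K * acc (af x y) v)
    (hPXstay : ∀ x y, hub x = hub y → Δ (comp x) (comp y) = 1 → W (bf x y) ≤ W (af x y) → PXf x y none none = 1 - ∑ v, PXf x y none (some v))
    (hPYoff : ∀ x y, hub x = hub y → Δ (comp x) (comp y) = 1 → W (bf x y) ≤ W (af x y) →
      ∀ h v, h ≠ v → PYf x y (some h) (some v) = if NCf x y h = 0 then 0 else (NCf x y v : ℝ) / K * acc h v)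
    (hPYin : ∀ x y, hub x = hub y → Δ (comp x) (comp y) = 1 → W (bf x y) ≤ W (af x y) →
      ∀ h, PYf x y (some h) none = if NCf x y h = 0 then 0 else acc h (bf x y) / K)
    (hPYdiag : ∀ x y, hub x = hub y → Δ (comp x) (comp y) = 1 → W (bf x y) ≤ W (af x y) →
      ∀ h, PYf x y (some h) (some h) = 1 - (∑ v ∈ univ.erase h, PYf x y (some h) (some v) + PYf x y (some h) none))
    (hPYout : ∀ x y, hub x = hub y → Δ (comp x) (comp y) = 1 → W (bf x y) ≤ W (af x y) → ∀ v, PYf x y none (some v) = (NCf x y v : ℝ) / K * acc (bf x y) v)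
    (hPYstay : ∀ x y, hub x = hub y → Δ (comp x) (comp y) = 1 → W (bf x y) ≤ W (af x y) → PYf x y none none = 1 - ∑ v, PYf x y none (some v))
    (hxtf : ∀ x y, hub x = hub y → Δ (comp x) (comp y) = 1 → W (bf x y) ≤ W (af x y) →
      ∀ t, xtf x y t = (1 - σ) * PXf x y (some (hub x)) t + σ * ∑ t', xtf x y t' * PXf x y t' t)
    (hytf : ∀ x y, hub x = hub y → Δ (comp x) (comp y) = 1 → W (bf x y) ≤ W (af x y) →
      ∀ t, ytf x y t = (1 - σ) * PYf x y (some (hub x)) t + σ * ∑ t', ytf x y t' * PYf x y t' t)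
    (hxsf : ∀ x y, hub x = hub y → Δ (comp x) (comp y) = 1 → W (bf x y) ≤ W (af x y) →
      ∀ t, xsf x y t = (1 - σ) * PXf x y none t + σ * ∑ t', xsf x y t' * PXf x y t' t)
    (hysf : ∀ x y, hub x = hub y → Δ (comp x) (comp y) = 1 → W (bf x y) ≤ W (af x y) →
      ∀ t, ysf x y t = (1 - σ) * PYf x y none t + σ * ∑ t', ysf x y t' * PYf x y t' t)
    {π : X → ℝ} (hπ : IsStationary π P) (hπ0 : ∀ x, 0 ≤ π x) (hπ1 : ∑ x, π x = 1) (n : ℕ) :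
    worstTvDist P π n ≤ ((K + 1) * (c + 2 * K + 2) + 2 * ((K + 1) * (c + 2 * K + 6))) * (1 - ρ) ^ n := by
  classical
  refine finiteOdds_domination_worstTvDist_le hinj hsum hsurj hhub hK hW hp0 hp hθ hacc hμ0 hμ1 hc hσ0 hσ1 hρ0 hρ hρc hKoff hKdiag hu hut hqt hq hΔ hP hQ hF hC hΨ
    horient hcx hcy hPXoff hPXin hPXdiag hPXout hPXstay hPYoff hPYin hPYdiag hPYout hPYstay hxtf hytf hxsf hysf ?_ ?_ hπ hπ0 hπ1 n
  all_goals intro x y hxy h1 hor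
  all_goals
    have ecx := hcx x y hxy h1 hor
    have ecy := hcy x y hxy h1 hor
    have hab : af x y ≠ bf x y := by
      intro e
      have : comp x = comp y := by rw [ecx, ecy, e]
      have h0 : Δ (comp x) (comp y) = 0 := by rw [this]; exact cdist_self hΔ _
      omega
    have hNC : ∑ v, NCf x y v = K := by
      have h := hsum x; rw [ecx] at h; simp only [Pi.add_apply] at h; rw [sum_add_distrib, Finset.sum_pi_single'] at h; simp at h; omega
    have hz : NCf x y (hub x) ≠ 0 := by
      by_cases hza : hub x = af x y
      · have h := hhub y; rw [ecy, ← hxy] at h; simp only [Pi.add_apply, Pi.single_apply] at h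
        rw [if_neg (fun e => hab (hza.symm.trans e))] at h; simpa using h
      · have h := hhub x; rw [ecx] at h; simp only [Pi.add_apply, Pi.single_apply, if_neg hza, add_zero] at h; exact h
  · exact tagged_hub_domination hW hacc hK hNC hor (hPXoff x y hxy h1 hor) (hPXin x y hxy h1 hor) (hPXdiag x y hxy h1 hor) (hPXout x y hxy h1 hor)
      (hPXstay x y hxy h1 hor) (hPYoff x y hxy h1 hor) (hPYin x y hxy h1 hor) (hPYdiag x y hxy h1 hor) (hPYout x y hxy h1 hor) (hPYstay x y hxy h1 hor)
      hσ0 hσ1 hz (hxtf x y hxy h1 hor) (hytf x y hxy h1 hor)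
  · exact tagged_star_domination hW hacc hK hNC hor (hPXoff x y hxy h1 hor) (hPXin x y hxy h1 hor) (hPXdiag x y hxy h1 hor) (hPXout x y hxy h1 hor)
      (hPXstay x y hxy h1 hor) (hPYoff x y hxy h1 hor) (hPYin x y hxy h1 hor) (hPYdiag x y hxy h1 hor) (hPYout x y hxy h1 hor) (hPYstay x y hxy h1 hor)
      hσ0 hσ1 (hxsf x y hxy h1 hor) (hysf x y hxy h1 hor) (hub x)

end Law

end Summit.Ventures.LatticeQCDFlow.Scaling
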